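import Literature.Geometry.Kaehler.ComplexTorusHodgeGroupFunctoriality
import Literature.Geometry.Kaehler.ComplexTorusHodgeGroupLieAlgebraCartan
import HarnessLib

/-!
# The Hodge Lie algebra of the dual torus: `𝔥𝔤_ℝ(X̂) = -ᵗ𝔥𝔤_ℝ(X) = ᵗ𝔥𝔤_ℝ(X)`, `dim_ℝ 𝔥𝔤_ℝ(X̂) = dim_ℝ 𝔥𝔤_ℝ(X)`,
# `𝔥𝔤_ℝ(X) ≃ₗ⁅ℝ⁆ 𝔥𝔤_ℝ(X̂)` via `X ↦ -ᵗX`; the Cartan data `𝔨`, `𝔭` of `X̂`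

Layer `Literature/Geometry/Kaehler`, namespace `Literature.Geometry.Kaehler.ComplexTorus`; lane `lit-hodgefound` (Track 2
foundations library), Layer A4, prover seat p17 (generation 17), self-proposed row g17-#7 — the INFINITESIMAL form of the
tree's `hodgeGroup_dual` (`Hg(X̂)(ℝ) = {ᵗM⁻¹ : M ∈ Hg(X)(ℝ)}`, GGK (I.B.3) for the contragredient representation,
`ComplexTorusHodgeGroupFunctoriality` §7: `contragredientSL`, `coe_contragredientSL`, `contragredientSL_contragredientSL`,
`jMatrix_dualPeriod` — `J_{X̂} = -ᵗJ_X`) on p40's carriers `hodgeGroupLie Φ = 𝔥𝔤_ℝ`, `hodgeIsotropyLie Φ = 𝔨`,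
`hodgeCartanP Φ = 𝔭` (`ComplexTorusHodgeGroupLieAlgebraCartan`: `mem_hodgeGroupLie_iff`, `mem_hodgeIsotropyLie_iff`,
`mem_hodgeCartanP_iff`), for the dual complex torus `X̂ = ComplexTorus (dualPeriod Φ)` (`ComplexTorusDual`).  The
derivative of `M ↦ ᵗM⁻¹` at `1` is `X ↦ -ᵗX`: `ᵗ(e^{tX})⁻¹ = e^{t(-ᵗX)}` (Hall Prop. 2.3 (2), (3) — Mathlib
`Matrix.exp_transpose`, `Matrix.exp_neg`).  Note that `X̂` need not be isogenous to `X` for a general torus, so this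
is NOT a case of the isogeny invariance of `𝔥𝔤_ℝ` (for abelian varieties it is, through `φ_L : X → X̂`).
Everything consumed BY NAME; THEOREMS ONLY (no definition, no named fact, no instance / no instance attribute), net debt 0.

## Sources, verbatim

* [GreenGriffithsKerr2012] M. Green, P. Griffiths, M. Kerr, *Mumford–Tate Groups and Domains* (2012), §I.B (I.B.3) (held
  `book:green2012-mumford-tate-groups-domains-their-geometry-arithmetic` p0039): "(I.B.3) `M_{ρ(φ̃)}` is the image of `M_φ̃`
  under the natural map `ρ : GL(V) → GL(V_ρ)`" — for the contragredient `ρ(g) = ᵗg⁻¹` on `V̌ = H₁(X̂, ℚ)`.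
* [Hall2015] B. C. Hall, GTM 222 (2015), Proposition 2.3 (held `galaxy-panama-293045618606123` p0040): "2. `(e^X)^* = e^{X^*}`.
  3. `e^X` is invertible and `(e^X)⁻¹ = e^{-X}`"; Theorem 3.28 (p0060): a Lie group homomorphism `Φ` induces `φ` with
  `Φ(e^X) = e^{φ(X)}`, "3. `φ(X) = d/dt Φ(e^{tX})|_{t=0}`", and Exercise 8 (isomorphic Lie groups have isomorphic Lie algebras).
* [Lange2023AbelianVarietiesComplex] H. Lange, *Abelian Varieties over the Complex Numbers* (2023), §1.4.1 (the dual complex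
  torus `X̂ = Ω̄/Λ̂`, `Ω̄ = Hom_{ℂ̄}(V, ℂ)`), §7.2.1 (the Hodge group).
* [Mostow1974StrongRigidity] G. D. Mostow (1973), §2.10 (p. 16): `K̇ = {X : σ̇(X) = X}`, `E = {X : σ̇(X) = -X}`.

## What is proved

* §1 THE CONTRAGREDIENT ON ONE-PARAMETER GROUPS: `coe_contragredientSL_eq_exp_smul` (`M = e^{tX} ∈ SL ⇒ ᵗM⁻¹ = e^{t(-ᵗX)}`).
* §2 `𝔥𝔤_ℝ(X̂)`: **`neg_transpose_mem_hodgeGroupLie_dual`** (`X ∈ 𝔥𝔤_ℝ(X) ⇒ -ᵗX ∈ 𝔥𝔤_ℝ(X̂)`), **`mem_hodgeGroupLie_dual_iff`**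
  (`Y ∈ 𝔥𝔤_ℝ(X̂) ⟺ -ᵗY ∈ 𝔥𝔤_ℝ(X)`), `transpose_mem_hodgeGroupLie_dual_iff` (`ᵗY ∈ 𝔥𝔤_ℝ(X̂) ⟺ Y ∈ 𝔥𝔤_ℝ(X)`),
  **`coe_hodgeGroupLie_dual`** (`𝔥𝔤_ℝ(X̂) = -ᵗ𝔥𝔤_ℝ(X)`), **`coe_hodgeGroupLie_dual_eq_image_transpose`** (`= ᵗ𝔥𝔤_ℝ(X)`),
  `hodgeGroupLie_dual_comm_iff`, **`finrank_hodgeGroupLie_dual`** (`dim_ℝ 𝔥𝔤_ℝ(X̂) = dim_ℝ 𝔥𝔤_ℝ(X)`),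
  **`nonempty_hodgeGroupLie_dual_lieEquiv`** (`𝔥𝔤_ℝ(X) ≃ₗ⁅ℝ⁆ 𝔥𝔤_ℝ(X̂)`, `X ↦ -ᵗX` is a Lie algebra isomorphism).
* §3 CARTAN DATA OF `X̂` (`J_{X̂} = -ᵗJ_X`): `jMatrix_dualPeriod_mul_neg_transpose`, `neg_transpose_mem_hodgeIsotropyLie_dual`, **`mem_hodgeIsotropyLie_dual_iff`**,
  `neg_transpose_mem_hodgeCartanP_dual`, **`mem_hodgeCartanP_dual_iff`**, **`finrank_hodgeIsotropyLie_dual`**,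
  **`finrank_hodgeCartanP_dual`**.

NOT here: the complex points `Lie Hg(X̂)(ℂ)` / `hodgeGroupComplexLie (dualPeriod Φ)` (the tree has no `hodgeGroupC` form of
`hodgeGroup_dual` yet), the Mumford–Tate versions (cf. `ComplexTorusMumfordTateGroupDual`), the double dual `X̂̂ ≅ X`.
-/

open scoped Matrix

open Set Function Matrix Module NormedSpace

namespace Literature.Geometry.Kaehler

namespace ComplexTorus

/-! ## §1 The contragredient on one-parameter groups: `ᵗ(e^{tX})⁻¹ = e^{t(-ᵗX)}` -/

section Contragredient

variable {ι : Type*} [Fintype ι] [DecidableEq ι]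

/-- `adj M = M⁻¹` for `det M = 1`. [folklore] -/
private theorem adjugate_eq_inv_of_det {M : Matrix ι ι ℝ} (h : M.det = 1) : M.adjugate = M⁻¹ := by
  rw [Matrix.inv_def, h, Ring.inverse_one, one_smul]

/-- **`ᵗ(e^{tX})⁻¹ = e^{t(-ᵗX)}`**: the contragredient `M ↦ ᵗM⁻¹` on a one-parameter group (`(e^X)⁻¹ = e^{-X}`,
`ᵗ(e^X) = e^{ᵗX}`). [cite: Hall2015, Proposition 2.3 (2), (3)] -/
theorem coe_contragredientSL_eq_exp_smul {M : SpecialLinearGroup ι ℝ} {t : ℝ} {X : Matrix ι ι ℝ}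
    (hM : (M : Matrix ι ι ℝ) = exp (t • X)) : (contragredientSL ι M : Matrix ι ι ℝ) = exp (t • (-Xᵀ)) := by
  rw [coe_contragredientSL, adjugate_eq_inv_of_det M.2, hM, ← Matrix.exp_neg, ← Matrix.exp_transpose,
    Matrix.transpose_neg, Matrix.transpose_smul, smul_neg]

end Contragredient

/-! ## §2 `𝔥𝔤_ℝ(X̂) = -ᵗ𝔥𝔤_ℝ(X) = ᵗ𝔥𝔤_ℝ(X)` -/

section Dual

variable {ι : Type*} [Fintype ι] [DecidableEq ι] {E : Type*} [NormedAddCommGroup E] [NormedSpace ℂ E]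
  (Φ : (ι → ℝ) ≃L[ℝ] E)

/-- **`X ∈ 𝔥𝔤_ℝ(X) ⇒ -ᵗX ∈ 𝔥𝔤_ℝ(X̂)`**: `e^{t(-ᵗX)} = ᵗ(e^{tX})⁻¹ ∈ ᵗHg(X)(ℝ)⁻¹ = Hg(X̂)(ℝ)` (the tree's `hodgeGroup_dual`).
[cite: GreenGriffithsKerr2012, §I.B (I.B.3)] [cite: Hall2015, Theorem 3.28 (3)] -/
theorem neg_transpose_mem_hodgeGroupLie_dual {X : Matrix ι ι ℝ} (hX : X ∈ hodgeGroupLie Φ) :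
    -Xᵀ ∈ hodgeGroupLie (dualPeriod Φ) := by
  rw [mem_hodgeGroupLie_iff] at hX ⊢
  intro t
  obtain ⟨M, hM, hMX⟩ := hX t
  refine ⟨contragredientSL ι M, ?_, coe_contragredientSL_eq_exp_smul hMX⟩
  rw [hodgeGroup_dual]
  exact Subgroup.mem_map_of_mem _ hM

/-- **`Y ∈ 𝔥𝔤_ℝ(X̂) ⟺ -ᵗY ∈ 𝔥𝔤_ℝ(X)`** (the contragredient is an involution). [cite: GreenGriffithsKerr2012, §I.B (I.B.3)]
[cite: Hall2015, Theorem 3.28 (3)] -/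
theorem mem_hodgeGroupLie_dual_iff {Y : Matrix ι ι ℝ} :
    Y ∈ hodgeGroupLie (dualPeriod Φ) ↔ -Yᵀ ∈ hodgeGroupLie Φ := by
  constructor
  · intro hY
    rw [mem_hodgeGroupLie_iff] at hY ⊢
    intro t
    obtain ⟨N, hN, hNY⟩ := hY t
    rw [hodgeGroup_dual, Subgroup.mem_map] at hN
    obtain ⟨M, hM, hMN⟩ := hN
    refine ⟨M, hM, ?_⟩
    rw [← contragredientSL_contragredientSL M, hMN]
    exact coe_contragredientSL_eq_exp_smul hNY
  · intro hY
    have h := neg_transpose_mem_hodgeGroupLie_dual Φ hY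
    rwa [Matrix.transpose_neg, Matrix.transpose_transpose, neg_neg] at h

/-- **`ᵗY ∈ 𝔥𝔤_ℝ(X̂) ⟺ Y ∈ 𝔥𝔤_ℝ(X)`** (`𝔥𝔤_ℝ` is closed under `X ↦ -X`). [cite: GreenGriffithsKerr2012, §I.B (I.B.3)] -/
theorem transpose_mem_hodgeGroupLie_dual_iff {Y : Matrix ι ι ℝ} :
    Yᵀ ∈ hodgeGroupLie (dualPeriod Φ) ↔ Y ∈ hodgeGroupLie Φ := by
  rw [mem_hodgeGroupLie_dual_iff, Matrix.transpose_transpose, neg_mem_iff]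

/-- **`𝔥𝔤_ℝ(X̂) = -ᵗ𝔥𝔤_ℝ(X)`**: the Lie algebra of `Hg(X̂)(ℝ) = ᵗHg(X)(ℝ)⁻¹` is the image of `𝔥𝔤_ℝ(X)` under the
derivative `X ↦ -ᵗX` of the contragredient. [cite: GreenGriffithsKerr2012, §I.B (I.B.3)] [cite: Hall2015, Theorem 3.28 (3)] -/
theorem coe_hodgeGroupLie_dual :
    (hodgeGroupLie (dualPeriod Φ) : Set (Matrix ι ι ℝ)) = (fun X ↦ -Xᵀ) '' (hodgeGroupLie Φ : Set (Matrix ι ι ℝ)) := by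
  ext Y
  constructor
  · intro hY
    refine ⟨-Yᵀ, (mem_hodgeGroupLie_dual_iff Φ).1 hY, ?_⟩
    simp only [Matrix.transpose_neg, Matrix.transpose_transpose, neg_neg]
  · rintro ⟨X, hX, rfl⟩
    exact neg_transpose_mem_hodgeGroupLie_dual Φ hX

/-- **`𝔥𝔤_ℝ(X̂) = ᵗ𝔥𝔤_ℝ(X)`** (a subspace is stable under `X ↦ -X`). [cite: GreenGriffithsKerr2012, §I.B (I.B.3)] -/
theorem coe_hodgeGroupLie_dual_eq_image_transpose :
    (hodgeGroupLie (dualPeriod Φ) : Set (Matrix ι ι ℝ)) = (fun X ↦ Xᵀ) '' (hodgeGroupLie Φ : Set (Matrix ι ι ℝ)) := by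
  ext Y
  constructor
  · intro hY
    refine ⟨Yᵀ, ?_, Matrix.transpose_transpose Y⟩
    exact (transpose_mem_hodgeGroupLie_dual_iff Φ).1 (by rwa [Matrix.transpose_transpose])
  · rintro ⟨X, hX, rfl⟩
    exact (transpose_mem_hodgeGroupLie_dual_iff Φ).2 hX

/-- **`𝔥𝔤_ℝ(X̂)` is commutative iff `𝔥𝔤_ℝ(X)` is** (so, with `hodgeGroupLie_comm_iff_…` of the tree, `X̂` is of CM-type
iff `X` is, infinitesimally; compare `hodgeGroup_dual_comm_iff`). [cite: GreenGriffithsKerr2012, §I.B (I.B.3)] [cite: Lange2023AbelianVarietiesComplex, §7.2.3 Prop. 7.2.6] -/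
theorem hodgeGroupLie_dual_comm_iff :
    (∀ X ∈ hodgeGroupLie (dualPeriod Φ), ∀ Y ∈ hodgeGroupLie (dualPeriod Φ), X * Y = Y * X) ↔
      ∀ X ∈ hodgeGroupLie Φ, ∀ Y ∈ hodgeGroupLie Φ, X * Y = Y * X := by
  constructor
  · intro h X hX Y hY
    have h' := h _ (neg_transpose_mem_hodgeGroupLie_dual Φ hX) _ (neg_transpose_mem_hodgeGroupLie_dual Φ hY)
    rw [neg_mul_neg, neg_mul_neg, ← Matrix.transpose_mul, ← Matrix.transpose_mul] at h'
    exact (Matrix.transpose_injective h').symm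
  · intro h X hX Y hY
    have h' := h _ ((mem_hodgeGroupLie_dual_iff Φ).1 hX) _ ((mem_hodgeGroupLie_dual_iff Φ).1 hY)
    rw [neg_mul_neg, neg_mul_neg, ← Matrix.transpose_mul, ← Matrix.transpose_mul] at h'
    exact (Matrix.transpose_injective h').symm

/-- **`dim_ℝ 𝔥𝔤_ℝ(X̂) = dim_ℝ 𝔥𝔤_ℝ(X)`** — transposition is a linear isomorphism of `M_ι(ℝ)` carrying `𝔥𝔤_ℝ(X)` onto
`𝔥𝔤_ℝ(X̂)`. [cite: GreenGriffithsKerr2012, §I.B (I.B.3)] [cite: Hall2015, Theorem 3.28 and Exercise 8] -/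
theorem finrank_hodgeGroupLie_dual : finrank ℝ (hodgeGroupLie (dualPeriod Φ)) = finrank ℝ (hodgeGroupLie Φ) := by
  letI : LieRing (Matrix ι ι ℝ) := LieRing.ofAssociativeRing
  change finrank ℝ (hodgeGroupLie (dualPeriod Φ)).toSubmodule = finrank ℝ (hodgeGroupLie Φ).toSubmodule
  have hmap : (hodgeGroupLie Φ).toSubmodule.map (Matrix.transposeLinearEquiv ι ι ℝ ℝ : Matrix ι ι ℝ →ₗ[ℝ] Matrix ι ι ℝ) =
      (hodgeGroupLie (dualPeriod Φ)).toSubmodule := by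
    refine SetLike.coe_injective ?_
    rw [Submodule.map_coe, LieSubalgebra.coe_toSubmodule, LieSubalgebra.coe_toSubmodule,
      coe_hodgeGroupLie_dual_eq_image_transpose Φ]
    rfl
  exact (((Matrix.transposeLinearEquiv ι ι ℝ ℝ).submoduleMap _).trans (LinearEquiv.ofEq _ _ hmap)).finrank_eq.symm

/-- **`𝔥𝔤_ℝ(X) ≃ₗ⁅ℝ⁆ 𝔥𝔤_ℝ(X̂)` via `X ↦ -ᵗX`** (the derivative of the contragredient is a Lie algebra automorphism of
`𝔤𝔩_ι(ℝ)`: `-ᵗ[X, Y] = [-ᵗX, -ᵗY]`). [cite: Hall2015, Theorem 3.28 (2), (3) and Exercise 8] [cite: GreenGriffithsKerr2012, §I.B (I.B.3)] -/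
theorem nonempty_hodgeGroupLie_dual_lieEquiv : Nonempty (hodgeGroupLie Φ ≃ₗ⁅ℝ⁆ hodgeGroupLie (dualPeriod Φ)) := by
  letI : LieRing (Matrix ι ι ℝ) := LieRing.ofAssociativeRing
  let e : Matrix ι ι ℝ ≃ₗ⁅ℝ⁆ Matrix ι ι ℝ :=
    { (Matrix.transposeLinearEquiv ι ι ℝ ℝ).trans (LinearEquiv.neg ℝ) with
      map_lie' := fun {X Y} ↦ by
        change -(X * Y - Y * X)ᵀ = -Xᵀ * -Yᵀ - -Yᵀ * -Xᵀ
        rw [Matrix.transpose_sub, Matrix.transpose_mul, Matrix.transpose_mul, neg_sub, neg_mul_neg, neg_mul_neg] }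
  have he : ∀ X, e X = -Xᵀ := fun X ↦ rfl
  have hmap : (hodgeGroupLie Φ).map (e : Matrix ι ι ℝ →ₗ⁅ℝ⁆ Matrix ι ι ℝ) = hodgeGroupLie (dualPeriod Φ) := by
    ext Y
    rw [LieSubalgebra.mem_map]
    constructor
    · rintro ⟨X, hX, rfl⟩
      exact neg_transpose_mem_hodgeGroupLie_dual Φ hX
    · intro hY
      refine ⟨-Yᵀ, (mem_hodgeGroupLie_dual_iff Φ).1 hY, (he _).trans ?_⟩
      rw [Matrix.transpose_neg, Matrix.transpose_transpose, neg_neg]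
  exact ⟨e.ofSubalgebras _ _ hmap⟩

/-! ## §3 The Cartan data of `X̂`: `𝔨(X̂) = -ᵗ𝔨(X)`, `𝔭(X̂) = -ᵗ𝔭(X)` (`J_{X̂} = -ᵗJ_X`) -/

/-- `J_{X̂} (-ᵗX) = ᵗ(XJ)` and `(-ᵗX) J_{X̂} = ᵗ(JX)`: with `J_{X̂} = -ᵗJ_X`, `X` commutes / anticommutes with `J_X` iff
`-ᵗX` does with `J_{X̂}`. [cite: Lange2023AbelianVarietiesComplex, §1.4.1] -/
theorem jMatrix_dualPeriod_mul_neg_transpose (X : Matrix ι ι ℝ) :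
    jMatrix (dualPeriod Φ) * -Xᵀ = (X * jMatrix Φ)ᵀ ∧ -Xᵀ * jMatrix (dualPeriod Φ) = (jMatrix Φ * X)ᵀ := by
  rw [jMatrix_dualPeriod, Matrix.transpose_mul, Matrix.transpose_mul, neg_mul_neg, neg_mul_neg]
  exact ⟨rfl, rfl⟩

/-- **`X ∈ 𝔨(X) ⇒ -ᵗX ∈ 𝔨(X̂)`.** [cite: Mostow1974StrongRigidity, §2.10 (p. 16)] [cite: GreenGriffithsKerr2012, §I.B (I.B.3)] -/
theorem neg_transpose_mem_hodgeIsotropyLie_dual {X : Matrix ι ι ℝ} (hX : X ∈ hodgeIsotropyLie Φ) :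
    -Xᵀ ∈ hodgeIsotropyLie (dualPeriod Φ) := by
  refine (mem_hodgeIsotropyLie_iff (Φ := dualPeriod Φ)).2 ⟨neg_transpose_mem_hodgeGroupLie_dual Φ hX.1, ?_⟩
  rw [(jMatrix_dualPeriod_mul_neg_transpose Φ X).1, (jMatrix_dualPeriod_mul_neg_transpose Φ X).2, hX.2]

/-- **`Y ∈ 𝔨(X̂) ⟺ -ᵗY ∈ 𝔨(X)`.** [cite: Mostow1974StrongRigidity, §2.10 (p. 16)] [cite: GreenGriffithsKerr2012, §I.B (I.B.3)] -/
theorem mem_hodgeIsotropyLie_dual_iff {Y : Matrix ι ι ℝ} :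
    Y ∈ hodgeIsotropyLie (dualPeriod Φ) ↔ -Yᵀ ∈ hodgeIsotropyLie Φ := by
  constructor
  · intro hY
    refine (mem_hodgeIsotropyLie_iff (Φ := Φ)).2 ⟨(mem_hodgeGroupLie_dual_iff Φ).1 hY.1, ?_⟩
    have h := hY.2
    have hY' : Y = -(-Yᵀ)ᵀ := by rw [Matrix.transpose_neg, Matrix.transpose_transpose, neg_neg]
    rw [hY', (jMatrix_dualPeriod_mul_neg_transpose Φ (-Yᵀ)).1, (jMatrix_dualPeriod_mul_neg_transpose Φ (-Yᵀ)).2] at h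
    exact (Matrix.transpose_injective h).symm
  · intro hY
    have h := neg_transpose_mem_hodgeIsotropyLie_dual Φ hY
    rwa [Matrix.transpose_neg, Matrix.transpose_transpose, neg_neg] at h

/-- **`X ∈ 𝔭(X) ⇒ -ᵗX ∈ 𝔭(X̂)`.** [cite: Mostow1974StrongRigidity, §2.10 (p. 16)] [cite: GreenGriffithsKerr2012, §I.B (I.B.3)] -/
theorem neg_transpose_mem_hodgeCartanP_dual {X : Matrix ι ι ℝ} (hX : X ∈ hodgeCartanP Φ) :
    -Xᵀ ∈ hodgeCartanP (dualPeriod Φ) := by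
  refine (mem_hodgeCartanP_iff (Φ := dualPeriod Φ)).2 ⟨neg_transpose_mem_hodgeGroupLie_dual Φ hX.1, ?_⟩
  rw [(jMatrix_dualPeriod_mul_neg_transpose Φ X).1, (jMatrix_dualPeriod_mul_neg_transpose Φ X).2, hX.2,
    Matrix.transpose_neg, neg_neg]

/-- **`Y ∈ 𝔭(X̂) ⟺ -ᵗY ∈ 𝔭(X)`.** [cite: Mostow1974StrongRigidity, §2.10 (p. 16)] [cite: GreenGriffithsKerr2012, §I.B (I.B.3)] -/
theorem mem_hodgeCartanP_dual_iff {Y : Matrix ι ι ℝ} :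
    Y ∈ hodgeCartanP (dualPeriod Φ) ↔ -Yᵀ ∈ hodgeCartanP Φ := by
  constructor
  · intro hY
    refine (mem_hodgeCartanP_iff (Φ := Φ)).2 ⟨(mem_hodgeGroupLie_dual_iff Φ).1 hY.1, ?_⟩
    have h := hY.2
    have hY' : Y = -(-Yᵀ)ᵀ := by rw [Matrix.transpose_neg, Matrix.transpose_transpose, neg_neg]
    rw [hY', (jMatrix_dualPeriod_mul_neg_transpose Φ (-Yᵀ)).1, (jMatrix_dualPeriod_mul_neg_transpose Φ (-Yᵀ)).2] at h
    have h2 : (jMatrix Φ * -Yᵀ)ᵀ = (-(-Yᵀ * jMatrix Φ))ᵀ := by rw [Matrix.transpose_neg, h, neg_neg]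
    exact Matrix.transpose_injective h2
  · intro hY
    have h := neg_transpose_mem_hodgeCartanP_dual Φ hY
    rwa [Matrix.transpose_neg, Matrix.transpose_transpose, neg_neg] at h

/-- **`dim_ℝ 𝔨(X̂) = dim_ℝ 𝔨(X)`.** [cite: Mostow1974StrongRigidity, §2.10 (p. 16)] [cite: GreenGriffithsKerr2012, §I.B (I.B.3)] -/
theorem finrank_hodgeIsotropyLie_dual :
    finrank ℝ (hodgeIsotropyLie (dualPeriod Φ)) = finrank ℝ (hodgeIsotropyLie Φ) := by
  letI : LieRing (Matrix ι ι ℝ) := LieRing.ofAssociativeRing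
  change finrank ℝ (hodgeIsotropyLie (dualPeriod Φ)).toSubmodule = finrank ℝ (hodgeIsotropyLie Φ).toSubmodule
  set f : Matrix ι ι ℝ ≃ₗ[ℝ] Matrix ι ι ℝ := (Matrix.transposeLinearEquiv ι ι ℝ ℝ).trans (LinearEquiv.neg ℝ) with hf
  have hfa : ∀ X, f X = -Xᵀ := fun X ↦ rfl
  have hmap : (hodgeIsotropyLie Φ).toSubmodule.map (f : Matrix ι ι ℝ →ₗ[ℝ] Matrix ι ι ℝ) =
      (hodgeIsotropyLie (dualPeriod Φ)).toSubmodule := by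
    ext Y
    simp only [Submodule.mem_map, LieSubalgebra.mem_toSubmodule, LinearEquiv.coe_coe, hfa]
    constructor
    · rintro ⟨X, hX, rfl⟩
      exact neg_transpose_mem_hodgeIsotropyLie_dual Φ hX
    · intro hY
      refine ⟨-Yᵀ, (mem_hodgeIsotropyLie_dual_iff Φ).1 hY, ?_⟩
      rw [Matrix.transpose_neg, Matrix.transpose_transpose, neg_neg]
  exact ((f.submoduleMap _).trans (LinearEquiv.ofEq _ _ hmap)).finrank_eq.symm

/-- **`dim_ℝ 𝔭(X̂) = dim_ℝ 𝔭(X)`.** [cite: Mostow1974StrongRigidity, §2.10 (p. 16)] [cite: GreenGriffithsKerr2012, §I.B (I.B.3)] -/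
theorem finrank_hodgeCartanP_dual : finrank ℝ (hodgeCartanP (dualPeriod Φ)) = finrank ℝ (hodgeCartanP Φ) := by
  set f : Matrix ι ι ℝ ≃ₗ[ℝ] Matrix ι ι ℝ := (Matrix.transposeLinearEquiv ι ι ℝ ℝ).trans (LinearEquiv.neg ℝ) with hf
  have hfa : ∀ X, f X = -Xᵀ := fun X ↦ rfl
  have hmap : (hodgeCartanP Φ).map (f : Matrix ι ι ℝ →ₗ[ℝ] Matrix ι ι ℝ) = hodgeCartanP (dualPeriod Φ) := by
    ext Y
    simp only [Submodule.mem_map, LinearEquiv.coe_coe, hfa]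
    constructor
    · rintro ⟨X, hX, rfl⟩
      exact neg_transpose_mem_hodgeCartanP_dual Φ hX
    · intro hY
      refine ⟨-Yᵀ, (mem_hodgeCartanP_dual_iff Φ).1 hY, ?_⟩
      rw [Matrix.transpose_neg, Matrix.transpose_transpose, neg_neg]
  exact ((f.submoduleMap _).trans (LinearEquiv.ofEq _ _ hmap)).finrank_eq.symm

end Dual

end ComplexTorus

end Literature.Geometry.Kaehler
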